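import Literature.NumberTheory.Transcendental.Analytification
import Literature.AlgebraicGeometry.Motives.VarietiesProjectiveSpaceProofs
import HarnessLib

/-!
# `ℙⁿ_k → Spec k` is smooth of relative dimension `n` (proof file)

Sibling proof file of `Literature/NumberTheory/Transcendental/Analytification.lean`. That file
vendors as a *named fact* `Literature.NumberTheory.Transcendental.smoothOfRelativeDimension_projectiveSpace k n`:
the structure morphism `ℙⁿ_k = Proj k[x₀, …, xₙ] ⟶ Spec k` of the accepted `k`-scheme
`Literature.AlgebraicGeometry.Motives.projectiveSpace n k` (`Proj.toSpecZero 𝒜 ≫ Spec (k → 𝒜 0)` for the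
grading `𝒜 = MvPolynomial.homogeneousSubmodule (Fin (n + 1)) k`) is smooth of relative dimension
`n` in the sense of Mathlib's `AlgebraicGeometry.SmoothOfRelativeDimension`. This file **discharges
that fact** (`Literature.NumberTheory.Transcendental.smoothOfRelativeDimension_projectiveSpace_holds`).

## Proof

[Hartshorne, *Algebraic Geometry*, III §10 Example 10.0.1, p. 268]: «For any `Y`, `𝔸ⁿ_Y` and
`ℙⁿ_Y` are smooth of relative dimension `n` over `Y`.» For `Y = Spec k` this is the first
component (`IsSmoothProjective.smoothOfRelativeDimension`) of the accepted discharge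
`Literature.AlgebraicGeometry.Motives.isSmoothProjective_projectiveSpace_holds k n` of
`Literature/AlgebraicGeometry/Motives/VarietiesProjectiveSpaceProofs.lean`
(`Literature.AlgebraicGeometry.Motives.ProjectiveSpace.smoothOfRelativeDimension_projToSpec`), proved
there from Mathlib as follows: `SmoothOfRelativeDimension n` is Zariski local at the source, with
ring-hom property `Locally (IsStandardSmoothOfRelativeDimension n)`
(`AlgebraicGeometry.HasRingHomProperty`); the standard charts `D₊(xᵢ) ≅ Spec (k[x₀, …, xₙ]_{xᵢ})₀`
(II Prop. 2.5 (b); Mathlib `Proj.awayι`) cover `ℙⁿ_k` since `x₀, …, xₙ` generate the irrelevant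
ideal; on `D₊(xᵢ)` the structure morphism is `Spec` of `k → (k[x]_{xᵢ})₀ ≃ₐ[k] k[y₁, …, yₙ]`
(I Thm. 3.4 (proof) and II Thm. 4.9 (proof): `D₊(xᵢ) ≅ Spec ℤ[x₀/xᵢ, …, xₙ/xᵢ]`); and a polynomial
ring in `n` variables is standard smooth of relative dimension `n` (tautological submersive
presentation without relations). Nothing is added to the import closure of `Analytification.lean`
itself: the discharge lives in this sibling file because `VarietiesProjectiveSpaceProofs` is not
among the imports of the fact's file.

## References

* R. Hartshorne, *Algebraic Geometry*, GTM 52, Springer (1977), doi:10.1007/978-1-4757-3849-0: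
  III §10 Definition and Example 10.0.1 (p. 268); II Prop. 2.5 (b) (pp. 76–77); II Thm. 4.9
  (proof); I Thm. 3.4 (proof, p. 18). [Hartshorne1977]
-/

noncomputable section

universe u

open CategoryTheory AlgebraicGeometry

namespace Literature.NumberTheory.Transcendental

/-- **Discharge of `Literature.NumberTheory.Transcendental.smoothOfRelativeDimension_projectiveSpace`**:
the structure morphism `ℙⁿ_k = Proj k[x₀, …, xₙ] ⟶ Spec k` of `Literature.projectiveSpace n k` is smooth
of relative dimension `n` (Mathlib `AlgebraicGeometry.SmoothOfRelativeDimension`), for every field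
`k` and every `n`. It is the `smoothOfRelativeDimension` field of the accepted
`Literature.AlgebraicGeometry.Motives.isSmoothProjective_projectiveSpace_holds k n` (proved there chart by chart on
the standard opens `D₊(xᵢ) ≅ 𝔸ⁿ_k`). In the printed source this is III §10, Example 10.0.1
(p. 268: «For any `Y`, `𝔸ⁿ_Y` and `ℙⁿ_Y` are smooth of relative dimension `n` over `Y`»), here
with `Y = Spec k`, the charts being those of II Prop. 2.5 (b) and II Thm. 4.9 (proof:
`D₊(xᵢ) ≅ Spec ℤ[x₀/xᵢ, …, xₙ/xᵢ]`); the locator «III Thm. 10.1» in the fact's docstring refers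
to this Example (Prop. 10.1 of loc. cit. is base change and composition of smooth morphisms).
[cite: Hartshorne1977, III §10 Example 10.0.1 (p. 268), with II Prop. 2.5 (b) and II Thm. 4.9 (proof)] -/
theorem smoothOfRelativeDimension_projectiveSpace_holds (k : Type u) [Field k] (n : ℕ) :
    smoothOfRelativeDimension_projectiveSpace k n :=
  (Literature.AlgebraicGeometry.Motives.isSmoothProjective_projectiveSpace_holds k n).smoothOfRelativeDimension

end Literature.NumberTheory.Transcendental
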